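import Summits.BirchSwinnertonDyer.Rank1Residual.X9.ChaDescentRecords
import HarnessLib

/-!
# Class X9, rank `0`, `ord₅ #Ш_an = 2`, image `5S4`: per-pair KERNEL RECORDS of the `μ`-free closure (Cha upper + full `5`-descent lower + Cassels–Tate) — companion of `X9/ChaDescentRecords.lean`

HONEST FRAMING (cell `b2b-bsdres-*`, verbatim): the cell deletes COMBINATION-SHAPED residual classes of
the rank-≤1 BSD formula from PUBLISHED theorems only and TYPES the construction-shaped remainder; this
is not "finishing BSD". Class X9 stays TYPED at class level; everything here is PER PAIR; no lane verdict
is changed; no named fact; nothing is booked by this unit. Unit `b2b-bsdres-x9`, gen 13.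

The generic consumer `bsdp_of_ainvs_of_cha_of_selmerGroup_ne_bot` (every Galois / CM / minimality hypothesis
decided from the integer model; see `X9/ChaDescentRecords.lean`) applied to the 8 rank-`0` X9 SHA rows with
image `5S4` (`38088v1`, `272484k1`, `272484k2`, `274752br1`, `347328cd1`, `374544bm1`, `374544bm2`, `464648c1`): UPPER half Cha 2005 with the census's index-`ord₅ = 1` Heegner rows (two engines), LOWER half the
full `5`-descent over the degree-`24` field `R = ℚ(E[5]∖0)` — unit `b2b-bsdres-x11c`'s gen-13 engine `s4desc`
(`HOME/code/b2b-bsdres-x11c/gen13/s4desc/`; method note `HOME/b2b-bsdres-x11c/gen13/S4DESCENT-METHOD.md`), byte copies run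
by this unit (kit j106749/j106443/j107029, + independent verifier): `dim_𝔽₅ Sel^(5)(E/ℚ) = 2` on every row.  CERTIFICATE STATUS, stated per record:
the class group of `R` enters through `bnfinit` and is GRH-conditional UNLESS an unconditional Zimmert certificate
(x11c's `zimmert` kit: every prime ideal of norm below the Bordellès–Zimmert bound decomposed and verified exactly) is
attached — for most of these fields the bound is out of reach (`|d_R| ~ 10⁴⁰…10⁴⁸`), so the `hSel` line of those records is
a GRH-conditional certificate and the pair's UNCONDITIONAL route of record remains gen 9's (`X9/IwasawaLowerBound.lean`:
lower half from BCS 2025 Thm 1.1.2 (a) + a `μ(𝓛₅(E)) = 0` certificate).  Census: `HOME/b2b-bsdres-x9/X9-CENSUS-G13.md` §1.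
[cite: Miller2011LMS, Thm. 5.2 and Def. 1.1] — see the companion file for the full reference list.
-/

set_option autoImplicit false

noncomputable section

open scoped Classical

open WeierstrassCurve Literature.NumberTheory.EllipticCurves
  Literature.NumberTheory.EllipticCurves.Rank1Residual
  Literature.NumberTheory.EllipticCurves.Rank1Residual.Typed
  Literature.NumberTheory.EllipticCurves.Rank1Residual.X11RankOneCertificates
  Summit.BirchSwinnertonDyer.BirchSwinnertonDyer.Rank1Residual.IntModel
  Summit.BirchSwinnertonDyer.BirchSwinnertonDyer.Rank1Residual.X11RankOne
  Summit.BirchSwinnertonDyer.Rank1Residual.X11b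

namespace Summit.BirchSwinnertonDyer.Rank1Residual.X9

/-! ### §1. Frobenius point-count certificates (kernel-decided data) -/

/-- `#Ẽ(𝔽_11) = 16` (`a_11 = -4`; `X² − a_11X + 11` root-free mod `5`) for Cremona's model `38088v1` (kernel count). [folklore] -/
theorem card_c38088v1_11 :
    Nat.card (((⟨0, 0, 0, 36501, -16230778⟩ : WeierstrassCurve ℤ).map (Int.castRingHom (ZMod 11))).toAffine.Point) = 16 := by
  rw [@WeierstrassCurve.natCard_point_eq_one_add_card (ZMod 11) (@ZMod.instField 11 ⟨by norm_num⟩) _ _ _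
    (by decide +kernel), @card_sol_eq_sum_euler (ZMod 11) (@ZMod.instField 11 ⟨by norm_num⟩) _ _
    (by rw [ZMod.ringChar_zmod_n]; decide), ZMod.card]
  decide +kernel

/-- `#Ẽ(𝔽_11) = 6` (`a_11 = 6`; `X² − a_11X + 11` root-free mod `5`) for Cremona's model `272484k1` (kernel count). [folklore] -/
theorem card_c272484k1_11 :
    Nat.card (((⟨0, 0, 0, 7569, -439002⟩ : WeierstrassCurve ℤ).map (Int.castRingHom (ZMod 11))).toAffine.Point) = 6 := by
  rw [@WeierstrassCurve.natCard_point_eq_one_add_card (ZMod 11) (@ZMod.instField 11 ⟨by norm_num⟩) _ _ _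
    (by decide +kernel), @card_sol_eq_sum_euler (ZMod 11) (@ZMod.instField 11 ⟨by norm_num⟩) _ _
    (by rw [ZMod.ringChar_zmod_n]; decide), ZMod.card]
  decide +kernel

/-- `#Ẽ(𝔽_11) = 6` (`a_11 = 6`; `X² − a_11X + 11` root-free mod `5`) for Cremona's model `272484k2` (kernel count). [folklore] -/
theorem card_c272484k2_11 :
    Nat.card (((⟨0, 0, 0, -295191, -61899282⟩ : WeierstrassCurve ℤ).map (Int.castRingHom (ZMod 11))).toAffine.Point) = 6 := by
  rw [@WeierstrassCurve.natCard_point_eq_one_add_card (ZMod 11) (@ZMod.instField 11 ⟨by norm_num⟩) _ _ _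
    (by decide +kernel), @card_sol_eq_sum_euler (ZMod 11) (@ZMod.instField 11 ⟨by norm_num⟩) _ _
    (by rw [ZMod.ringChar_zmod_n]; decide), ZMod.card]
  decide +kernel

/-- `#Ẽ(𝔽_11) = 8` (`a_11 = 4`; `X² − a_11X + 11` root-free mod `5`) for Cremona's model `274752br1` (kernel count). [folklore] -/
theorem card_c274752br1_11 :
    Nat.card (((⟨0, 0, 0, -64224, -5261472⟩ : WeierstrassCurve ℤ).map (Int.castRingHom (ZMod 11))).toAffine.Point) = 8 := by
  rw [@WeierstrassCurve.natCard_point_eq_one_add_card (ZMod 11) (@ZMod.instField 11 ⟨by norm_num⟩) _ _ _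
    (by decide +kernel), @card_sol_eq_sum_euler (ZMod 11) (@ZMod.instField 11 ⟨by norm_num⟩) _ _
    (by rw [ZMod.ringChar_zmod_n]; decide), ZMod.card]
  decide +kernel

/-- `#Ẽ(𝔽_11) = 8` (`a_11 = 4`; `X² − a_11X + 11` root-free mod `5`) for Cremona's model `347328cd1` (kernel count). [folklore] -/
theorem card_c347328cd1_11 :
    Nat.card (((⟨0, 0, 0, -578304, -169277832⟩ : WeierstrassCurve ℤ).map (Int.castRingHom (ZMod 11))).toAffine.Point) = 8 := by
  rw [@WeierstrassCurve.natCard_point_eq_one_add_card (ZMod 11) (@ZMod.instField 11 ⟨by norm_num⟩) _ _ _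
    (by decide +kernel), @card_sol_eq_sum_euler (ZMod 11) (@ZMod.instField 11 ⟨by norm_num⟩) _ _
    (by rw [ZMod.ringChar_zmod_n]; decide), ZMod.card]
  decide +kernel

/-- `#Ẽ(𝔽_11) = 6` (`a_11 = 6`; `X² − a_11X + 11` root-free mod `5`) for Cremona's model `374544bm1` (kernel count). [folklore] -/
theorem card_c374544bm1_11 :
    Nat.card (((⟨0, 0, 0, -11271, -461822⟩ : WeierstrassCurve ℤ).map (Int.castRingHom (ZMod 11))).toAffine.Point) = 6 := by
  rw [@WeierstrassCurve.natCard_point_eq_one_add_card (ZMod 11) (@ZMod.instField 11 ⟨by norm_num⟩) _ _ _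
    (by decide +kernel), @card_sol_eq_sum_euler (ZMod 11) (@ZMod.instField 11 ⟨by norm_num⟩) _ _
    (by rw [ZMod.ringChar_zmod_n]; decide), ZMod.card]
  decide +kernel

/-- `#Ẽ(𝔽_11) = 6` (`a_11 = 6`; `X² − a_11X + 11` root-free mod `5`) for Cremona's model `374544bm2` (kernel count). [folklore] -/
theorem card_c374544bm2_11 :
    Nat.card (((⟨0, 0, 0, 23409, -2387718⟩ : WeierstrassCurve ℤ).map (Int.castRingHom (ZMod 11))).toAffine.Point) = 6 := by
  rw [@WeierstrassCurve.natCard_point_eq_one_add_card (ZMod 11) (@ZMod.instField 11 ⟨by norm_num⟩) _ _ _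
    (by decide +kernel), @card_sol_eq_sum_euler (ZMod 11) (@ZMod.instField 11 ⟨by norm_num⟩) _ _
    (by rw [ZMod.ringChar_zmod_n]; decide), ZMod.card]
  decide +kernel

/-- `#Ẽ(𝔽_3) = 4` (`a_3 = 0`; `X² − a_3X + 3` root-free mod `5`) for Cremona's model `464648c1` (kernel count). [folklore] -/
theorem card_c464648c1_3 :
    Nat.card (((⟨0, 0, 0, -153972731, -735401758298⟩ : WeierstrassCurve ℤ).map (Int.castRingHom (ZMod 3))).toAffine.Point) = 4 := by
  rw [@WeierstrassCurve.natCard_point_eq_one_add_card (ZMod 3) (@ZMod.instField 3 ⟨by norm_num⟩) _ _ _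
    (by decide +kernel), @card_sol_eq_sum_euler (ZMod 3) (@ZMod.instField 3 ⟨by norm_num⟩) _ _
    (by rw [ZMod.ringChar_zmod_n]; decide), ZMod.card]
  decide +kernel

/-! ### §2. The records -/

/-- **`BSD(E,5)` for `38088v1`** (`N = 38088 = 2³·3²·23²`; `5 ∤ N`: GOOD ORDINARY at `5`, `a₅ = 2` — class X9; Cremona model
`[0, 0, 0, 36501, -16230778]`; `ρ̄_{E,5}` irreducible, NOT surjective, of exceptional type `5S4`; analytic rank `0`, `#Ш_an = 25` (`ord₅ = 2`);
c₂ = 1 (II*), c₃ = 1 (I0*), c₂₃ = 1 (IV*); bad primes `2` add, `3` add, `23` add; `j = 46`) — an X9 "SHA row", closed here `μ`-FREE: UPPER half Cha 2005 with the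
Heegner-index certificate of the X9 census — index-`ord₅ = 1` rows (two engines, `m_e1 = m_e2`; `HOME/b2b-bsdres-x9/g12/fold/fold_g12.rows.tsv`):
`D = -143`, `m = 20` (engine 1 j070731, ENGINE 2 agree) — so `ord₅ [E(K) : ℤ y_K] ≤ 1` —, LOWER half the
descent line: `dim_𝔽₅ Sel^(5)(E/ℚ) = 2` (engine mode `GRH`; `S = [2, 3, 5, 13, 23]`, `Cl(R) = [20, [10, 2]]`, `Cl_S(R) = [1, []]`, `#gens R(S,5) = 32`, `dim K_S(R) = 0`, `5`-saturation `[1, 168, 32]`, all local images complete; independent verifier j106749: VERIFIED) — x11c gen-13 `s4desc` full `5`-descent over `R`, byte copies, this unit's run of record kit j106749; class group of the degree-`24` field `R = ℚ(E[5]∖0)` from `bnfinit` UNDER GRH (Zimmert certificate not attached: this line is GRH-CONDITIONAL); so `Ш(E)[5] ≠ 0`, `25 ∣ #Ш` (Cassels–Tate), `ord₅ #Ш ≤ 2` (Cha): `#Ш(E)[5^∞] = 25`. Kernel-decided: `Δ ≠ 0`, global minimality (Kraus),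
`E[5]` irreducible (`ℓ = 11`, `#Ẽ(𝔽_11) = 16`, `a_11 = -4`, `X² − a_11X + 11` root-free mod `5`), non-CM (`j ∉` the 13 CM values).
Binders: `hGZK`, `hCT`, `hCha` (published); `r_an = 0`, `#Ш_an` (`ord₅ = 2`), the Heegner datum with its index certificate, `hSel` (the descent line).
[cite: Miller2011LMS, Thm. 5.2 and Def. 1.1] [cite: SilvermanAEC2009, Thm. X.4.14] [cite: Cremona2006, Table 1 (Cremona label 38088v1)] -/
theorem bsdp_c38088v1 (hGZK : rank_eq_analyticRank_of_analyticRank_le_one)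
    (hCT : exists_casselsTate_pairing (K := ℚ)) (hCha : Cha2005.thm52_padicValNat_shaOrder_le)
    (W : WeierstrassCurve ℚ) (hW : W = ⟨0, 0, 0, 36501, -16230778⟩)
    (hr : W.analyticRank = 0)
    {N : ℕ} [NeZero N] {K : Type} [Field K] [NumberField K] (hK : IsImaginaryQuadratic K)
    (hH : SatisfiesHeegnerHypothesis N K) {P : (W.baseChange K).toAffine.Point}
    (hP : IsHeegnerPoint N W K P) (hnt : ¬ IsOfFinAddOrder P)
    (hpD : ¬ (5 : ℤ) ∣ NumberField.discr K) (hpN : ¬ 5 ^ 2 ∣ N)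
    (hI : padicValNat 5 (AddSubgroup.zmultiples P).index ≤ 1)
    {q : ℚ} (hq : shaAn W = (q : ℂ)) (hv : padicValRat 5 q = 2)
    (hSel : W.selmerGroup (5 : ℤ) ≠ ⊥) : BSDp W 5 := by
  subst hW
  haveI := isElliptic_of_discOf_ne_zero 0 0 0 36501 (-16230778) (by decide +kernel)
  haveI := isGloballyMinimal_of_krausCriterion_bounded₂ 0 0 0 36501 (-16230778) (by decide +kernel) (by decide +kernel)
    (by decide +kernel)
  haveI : Fact (Nat.Prime 5) := ⟨by norm_num⟩
  haveI : Fact (Nat.Prime 11) := ⟨by norm_num⟩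
  exact bsdp_of_ainvs_of_cha_of_selmerGroup_ne_bot hGZK hCT hCha 0 0 0 36501 (-16230778)
    (integralModelInt_eq_of_map_eq _ (map_mk_int _ _ _ _ _)) 5 11 16 (by decide) (by decide +kernel)
    (by decide) (by decide +kernel) card_c38088v1_11 (by decide +kernel) hr hK hH hP hnt
    (mod_cast hpD) hpN hI hq hv hSel

/-- **`BSD(E,5)` for `272484k1`** (`N = 272484 = 2²·3⁴·29²`; `5 ∤ N`: GOOD ORDINARY at `5`, `a₅ = 3` — class X9; Cremona model
`[0, 0, 0, 7569, -439002]`; `ρ̄_{E,5}` irreducible, NOT surjective, of exceptional type `5S4`; analytic rank `0`, `#Ш_an = 25` (`ord₅ = 2`);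
c₂ = 1 (IV*), c₃ = 1 (IV), c₂₉ = 1 (I0*); bad primes `2` add, `3` add, `29` add; `j = 432`) — an X9 "SHA row", closed here `μ`-FREE: UPPER half Cha 2005 with the
Heegner-index certificate of the X9 census — index-`ord₅ = 1` rows (two engines, `m_e1 = m_e2`; `HOME/b2b-bsdres-x9/g12/fold/fold_g12.rows.tsv`):
`D = -23`, `m = 10` (engine 1 j070736,j073713, ENGINE 2 agree); `D = -71`, `m = 10` (engine 1 j073713, ENGINE 2 agree) — so `ord₅ [E(K) : ℤ y_K] ≤ 1` —, LOWER half the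
descent line: `dim_𝔽₅ Sel^(5)(E/ℚ) = 2` (engine mode `GRH`; `S = [2, 3, 5, 17, 29]`, `Cl(R) = [20, [10, 2]]`, `Cl_S(R) = [1, []]`, `#gens R(S,5) = 29`, `dim K_S(R) = 0`, `5`-saturation `[1, 133, 29]`, all local images complete; independent verifier j107029: VERIFIED) — x11c gen-13 `s4desc` full `5`-descent over `R`, byte copies, this unit's run of record kit j107029; class group of the degree-`24` field `R = ℚ(E[5]∖0)` from `bnfinit` UNDER GRH (Zimmert certificate not attached: this line is GRH-CONDITIONAL); so `Ш(E)[5] ≠ 0`, `25 ∣ #Ш` (Cassels–Tate), `ord₅ #Ш ≤ 2` (Cha): `#Ш(E)[5^∞] = 25`. Kernel-decided: `Δ ≠ 0`, global minimality (Kraus),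
`E[5]` irreducible (`ℓ = 11`, `#Ẽ(𝔽_11) = 6`, `a_11 = 6`, `X² − a_11X + 11` root-free mod `5`), non-CM (`j ∉` the 13 CM values).
Binders: `hGZK`, `hCT`, `hCha` (published); `r_an = 0`, `#Ш_an` (`ord₅ = 2`), the Heegner datum with its index certificate, `hSel` (the descent line).
[cite: Miller2011LMS, Thm. 5.2 and Def. 1.1] [cite: SilvermanAEC2009, Thm. X.4.14] [cite: Cremona2006, Table 1 (Cremona label 272484k1)] -/
theorem bsdp_c272484k1 (hGZK : rank_eq_analyticRank_of_analyticRank_le_one)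
    (hCT : exists_casselsTate_pairing (K := ℚ)) (hCha : Cha2005.thm52_padicValNat_shaOrder_le)
    (W : WeierstrassCurve ℚ) (hW : W = ⟨0, 0, 0, 7569, -439002⟩)
    (hr : W.analyticRank = 0)
    {N : ℕ} [NeZero N] {K : Type} [Field K] [NumberField K] (hK : IsImaginaryQuadratic K)
    (hH : SatisfiesHeegnerHypothesis N K) {P : (W.baseChange K).toAffine.Point}
    (hP : IsHeegnerPoint N W K P) (hnt : ¬ IsOfFinAddOrder P)
    (hpD : ¬ (5 : ℤ) ∣ NumberField.discr K) (hpN : ¬ 5 ^ 2 ∣ N)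
    (hI : padicValNat 5 (AddSubgroup.zmultiples P).index ≤ 1)
    {q : ℚ} (hq : shaAn W = (q : ℂ)) (hv : padicValRat 5 q = 2)
    (hSel : W.selmerGroup (5 : ℤ) ≠ ⊥) : BSDp W 5 := by
  subst hW
  haveI := isElliptic_of_discOf_ne_zero 0 0 0 7569 (-439002) (by decide +kernel)
  haveI := isGloballyMinimal_of_krausCriterion_bounded₂ 0 0 0 7569 (-439002) (by decide +kernel) (by decide +kernel)
    (by decide +kernel)
  haveI : Fact (Nat.Prime 5) := ⟨by norm_num⟩
  haveI : Fact (Nat.Prime 11) := ⟨by norm_num⟩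
  exact bsdp_of_ainvs_of_cha_of_selmerGroup_ne_bot hGZK hCT hCha 0 0 0 7569 (-439002)
    (integralModelInt_eq_of_map_eq _ (map_mk_int _ _ _ _ _)) 5 11 6 (by decide) (by decide +kernel)
    (by decide) (by decide +kernel) card_c272484k1_11 (by decide +kernel) hr hK hH hP hnt
    (mod_cast hpD) hpN hI hq hv hSel

/-- **`BSD(E,5)` for `272484k2`** (`N = 272484 = 2²·3⁴·29²`; `5 ∤ N`: GOOD ORDINARY at `5`, `a₅ = 3` — class X9; Cremona model
`[0, 0, 0, -295191, -61899282]`; `ρ̄_{E,5}` irreducible, NOT surjective, of exceptional type `5S4`; analytic rank `0`, `#Ш_an = 25` (`ord₅ = 2`);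
c₂ = 3 (IV*), c₃ = 1 (IV*), c₂₉ = 1 (I0*); bad primes `2` add, `3` add, `29` add; `j = -316368`) — an X9 "SHA row", closed here `μ`-FREE: UPPER half Cha 2005 with the
Heegner-index certificate of the X9 census — index-`ord₅ = 1` rows (two engines, `m_e1 = m_e2`; `HOME/b2b-bsdres-x9/g12/fold/fold_g12.rows.tsv`):
`D = -23`, `m = 30` (engine 1 j070729, ENGINE 2 agree) — so `ord₅ [E(K) : ℤ y_K] ≤ 1` —, LOWER half the
descent line: `dim_𝔽₅ Sel^(5)(E/ℚ) = 2` (engine mode `GRH`; `S = [2, 3, 5, 17, 29]`, `Cl(R) = [20, [10, 2]]`, `Cl_S(R) = [1, []]`, `#gens R(S,5) = 29`, `dim K_S(R) = 0`, `5`-saturation `[1, 124, 29]`, all local images complete; independent verifier j107029: VERIFIED) — x11c gen-13 `s4desc` full `5`-descent over `R`, byte copies, this unit's run of record kit j107029; class group of the degree-`24` field `R = ℚ(E[5]∖0)` from `bnfinit` UNDER GRH (Zimmert certificate not attached: this line is GRH-CONDITIONAL); so `Ш(E)[5] ≠ 0`, `25 ∣ #Ш` (Cassels–Tate), `ord₅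 #Ш ≤ 2` (Cha): `#Ш(E)[5^∞] = 25`. Kernel-decided: `Δ ≠ 0`, global minimality (Kraus),
`E[5]` irreducible (`ℓ = 11`, `#Ẽ(𝔽_11) = 6`, `a_11 = 6`, `X² − a_11X + 11` root-free mod `5`), non-CM (`j ∉` the 13 CM values).
Binders: `hGZK`, `hCT`, `hCha` (published); `r_an = 0`, `#Ш_an` (`ord₅ = 2`), the Heegner datum with its index certificate, `hSel` (the descent line).
[cite: Miller2011LMS, Thm. 5.2 and Def. 1.1] [cite: SilvermanAEC2009, Thm. X.4.14] [cite: Cremona2006, Table 1 (Cremona label 272484k2)] -/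
theorem bsdp_c272484k2 (hGZK : rank_eq_analyticRank_of_analyticRank_le_one)
    (hCT : exists_casselsTate_pairing (K := ℚ)) (hCha : Cha2005.thm52_padicValNat_shaOrder_le)
    (W : WeierstrassCurve ℚ) (hW : W = ⟨0, 0, 0, -295191, -61899282⟩)
    (hr : W.analyticRank = 0)
    {N : ℕ} [NeZero N] {K : Type} [Field K] [NumberField K] (hK : IsImaginaryQuadratic K)
    (hH : SatisfiesHeegnerHypothesis N K) {P : (W.baseChange K).toAffine.Point}
    (hP : IsHeegnerPoint N W K P) (hnt : ¬ IsOfFinAddOrder P)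
    (hpD : ¬ (5 : ℤ) ∣ NumberField.discr K) (hpN : ¬ 5 ^ 2 ∣ N)
    (hI : padicValNat 5 (AddSubgroup.zmultiples P).index ≤ 1)
    {q : ℚ} (hq : shaAn W = (q : ℂ)) (hv : padicValRat 5 q = 2)
    (hSel : W.selmerGroup (5 : ℤ) ≠ ⊥) : BSDp W 5 := by
  subst hW
  haveI := isElliptic_of_discOf_ne_zero 0 0 0 (-295191) (-61899282) (by decide +kernel)
  haveI := isGloballyMinimal_of_krausCriterion_bounded₂ 0 0 0 (-295191) (-61899282) (by decide +kernel) (by decide +kernel)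
    (by decide +kernel)
  haveI : Fact (Nat.Prime 5) := ⟨by norm_num⟩
  haveI : Fact (Nat.Prime 11) := ⟨by norm_num⟩
  exact bsdp_of_ainvs_of_cha_of_selmerGroup_ne_bot hGZK hCT hCha 0 0 0 (-295191) (-61899282)
    (integralModelInt_eq_of_map_eq _ (map_mk_int _ _ _ _ _)) 5 11 6 (by decide) (by decide +kernel)
    (by decide) (by decide +kernel) card_c272484k2_11 (by decide +kernel) hr hK hH hP hnt
    (mod_cast hpD) hpN hI hq hv hSel

/-- **`BSD(E,5)` for `274752br1`** (`N = 274752 = 2⁶·3⁴·53`; `5 ∤ N`: GOOD ORDINARY at `5`, `a₅ = 2` — class X9; Cremona model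
`[0, 0, 0, -64224, -5261472]`; `ρ̄_{E,5}` irreducible, NOT surjective, of exceptional type `5S4`; analytic rank `0`, `#Ш_an = 25` (`ord₅ = 2`);
c₂ = 1 (II*), c₃ = 1 (IV), c₅₃ = 1 (I5); bad primes `2` add, `3` add, `53` mult; `j = 2452834787328/418195493`) — an X9 "SHA row", closed here `μ`-FREE: UPPER half Cha 2005 with the
Heegner-index certificate of the X9 census — index-`ord₅ = 1` rows (two engines, `m_e1 = m_e2`; `HOME/b2b-bsdres-x9/g12/fold/fold_g12.rows.tsv`):
`D = -47`, `m = 20` (engine 1 j070731, ENGINE 2 agree) — so `ord₅ [E(K) : ℤ y_K] ≤ 1` —, LOWER half the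
descent line: `dim_𝔽₅ Sel^(5)(E/ℚ) = 2` (engine mode `GRH`; `S = [2, 3, 5, 7, 53]`, `Cl(R) = [10, [10]]`, `Cl_S(R) = [1, []]`, `#gens R(S,5) = 34`, `dim K_S(R) = 0`, `5`-saturation `[1, 114, 34]`, all local images complete; independent verifier j107225: VERIFIED) — x11c gen-13 `s4desc` full `5`-descent over `R`, byte copies, this unit's run of record kit j106443; class group of the degree-`24` field `R = ℚ(E[5]∖0)` from `bnfinit` UNDER GRH (Zimmert certificate not attached: this line is GRH-CONDITIONAL); so `Ш(E)[5] ≠ 0`, `25 ∣ #Ш` (Cassels–Tate), `ord₅ #Ш ≤ 2` (Cha): `#Ш(E)[5^∞] = 25`. Kernel-decided: `Δ ≠ 0`, global minimality (Kraus),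
`E[5]` irreducible (`ℓ = 11`, `#Ẽ(𝔽_11) = 8`, `a_11 = 4`, `X² − a_11X + 11` root-free mod `5`), non-CM (`j ∉` the 13 CM values).
Binders: `hGZK`, `hCT`, `hCha` (published); `r_an = 0`, `#Ш_an` (`ord₅ = 2`), the Heegner datum with its index certificate, `hSel` (the descent line).
[cite: Miller2011LMS, Thm. 5.2 and Def. 1.1] [cite: SilvermanAEC2009, Thm. X.4.14] [cite: Cremona2006, Table 1 (Cremona label 274752br1)] -/
theorem bsdp_c274752br1 (hGZK : rank_eq_analyticRank_of_analyticRank_le_one)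
    (hCT : exists_casselsTate_pairing (K := ℚ)) (hCha : Cha2005.thm52_padicValNat_shaOrder_le)
    (W : WeierstrassCurve ℚ) (hW : W = ⟨0, 0, 0, -64224, -5261472⟩)
    (hr : W.analyticRank = 0)
    {N : ℕ} [NeZero N] {K : Type} [Field K] [NumberField K] (hK : IsImaginaryQuadratic K)
    (hH : SatisfiesHeegnerHypothesis N K) {P : (W.baseChange K).toAffine.Point}
    (hP : IsHeegnerPoint N W K P) (hnt : ¬ IsOfFinAddOrder P)
    (hpD : ¬ (5 : ℤ) ∣ NumberField.discr K) (hpN : ¬ 5 ^ 2 ∣ N)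
    (hI : padicValNat 5 (AddSubgroup.zmultiples P).index ≤ 1)
    {q : ℚ} (hq : shaAn W = (q : ℂ)) (hv : padicValRat 5 q = 2)
    (hSel : W.selmerGroup (5 : ℤ) ≠ ⊥) : BSDp W 5 := by
  subst hW
  haveI := isElliptic_of_discOf_ne_zero 0 0 0 (-64224) (-5261472) (by decide +kernel)
  haveI := isGloballyMinimal_of_krausCriterion_bounded₂ 0 0 0 (-64224) (-5261472) (by decide +kernel) (by decide +kernel)
    (by decide +kernel)
  haveI : Fact (Nat.Prime 5) := ⟨by norm_num⟩
  haveI : Fact (Nat.Prime 11) := ⟨by norm_num⟩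
  exact bsdp_of_ainvs_of_cha_of_selmerGroup_ne_bot hGZK hCT hCha 0 0 0 (-64224) (-5261472)
    (integralModelInt_eq_of_map_eq _ (map_mk_int _ _ _ _ _)) 5 11 8 (by decide) (by decide +kernel)
    (by decide) (by decide +kernel) card_c274752br1_11 (by decide +kernel) hr hK hH hP hnt
    (mod_cast hpD) hpN hI hq hv hSel

/-- **`BSD(E,5)` for `347328cd1`** (`N = 347328 = 2⁶·3⁴·67`; `5 ∤ N`: GOOD ORDINARY at `5`, `a₅ = 2` — class X9; Cremona model
`[0, 0, 0, -578304, -169277832]`; `ρ̄_{E,5}` irreducible, NOT surjective, of exceptional type `5S4`; analytic rank `0`, `#Ш_an = 25` (`ord₅ = 2`);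
c₂ = 2 (I0*), c₃ = 1 (IV), c₆₇ = 1 (I5); bad primes `2` add, `3` add, `67` mult; `j = -28652651390435328/1350125107`) — an X9 "SHA row", closed here `μ`-FREE: UPPER half Cha 2005 with the
Heegner-index certificate of the X9 census — index-`ord₅ = 1` rows (two engines, `m_e1 = m_e2`; `HOME/b2b-bsdres-x9/g12/fold/fold_g12.rows.tsv`):
`D = -407`, `m = 40` (engine 1 j073706, ENGINE 2 agree) — so `ord₅ [E(K) : ℤ y_K] ≤ 1` —, LOWER half the
descent line: `dim_𝔽₅ Sel^(5)(E/ℚ) = 2` (engine mode `GRH`; `S = [2, 3, 5, 7, 67]`, `Cl(R) = [10, [10]]`, `Cl_S(R) = [1, []]`, `#gens R(S,5) = 34`, `dim K_S(R) = 0`, `5`-saturation `[1, 114, 34]`, all local images complete; independent verifier j107225: VERIFIED) — x11c gen-13 `s4desc` full `5`-descent over `R`, byte copies, this unit's run of record kit j106443; class group of the degree-`24` field `R = ℚ(E[5]∖0)` from `bnfinit` UNDER GRH (Zimmert certificate not attached: this line is GRH-CONDITIONAL); so `Ш(E)[5] ≠ 0`, `25 ∣ #Ш` (Cassels–Tate),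 `ord₅ #Ш ≤ 2` (Cha): `#Ш(E)[5^∞] = 25`. Kernel-decided: `Δ ≠ 0`, global minimality (Kraus),
`E[5]` irreducible (`ℓ = 11`, `#Ẽ(𝔽_11) = 8`, `a_11 = 4`, `X² − a_11X + 11` root-free mod `5`), non-CM (`j ∉` the 13 CM values).
Binders: `hGZK`, `hCT`, `hCha` (published); `r_an = 0`, `#Ш_an` (`ord₅ = 2`), the Heegner datum with its index certificate, `hSel` (the descent line).
[cite: Miller2011LMS, Thm. 5.2 and Def. 1.1] [cite: SilvermanAEC2009, Thm. X.4.14] [cite: Cremona2006, Table 1 (Cremona label 347328cd1)] -/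
theorem bsdp_c347328cd1 (hGZK : rank_eq_analyticRank_of_analyticRank_le_one)
    (hCT : exists_casselsTate_pairing (K := ℚ)) (hCha : Cha2005.thm52_padicValNat_shaOrder_le)
    (W : WeierstrassCurve ℚ) (hW : W = ⟨0, 0, 0, -578304, -169277832⟩)
    (hr : W.analyticRank = 0)
    {N : ℕ} [NeZero N] {K : Type} [Field K] [NumberField K] (hK : IsImaginaryQuadratic K)
    (hH : SatisfiesHeegnerHypothesis N K) {P : (W.baseChange K).toAffine.Point}
    (hP : IsHeegnerPoint N W K P) (hnt : ¬ IsOfFinAddOrder P)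
    (hpD : ¬ (5 : ℤ) ∣ NumberField.discr K) (hpN : ¬ 5 ^ 2 ∣ N)
    (hI : padicValNat 5 (AddSubgroup.zmultiples P).index ≤ 1)
    {q : ℚ} (hq : shaAn W = (q : ℂ)) (hv : padicValRat 5 q = 2)
    (hSel : W.selmerGroup (5 : ℤ) ≠ ⊥) : BSDp W 5 := by
  subst hW
  haveI := isElliptic_of_discOf_ne_zero 0 0 0 (-578304) (-169277832) (by decide +kernel)
  haveI := isGloballyMinimal_of_krausCriterion_bounded₂ 0 0 0 (-578304) (-169277832) (by decide +kernel) (by decide +kernel)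
    (by decide +kernel)
  haveI : Fact (Nat.Prime 5) := ⟨by norm_num⟩
  haveI : Fact (Nat.Prime 11) := ⟨by norm_num⟩
  exact bsdp_of_ainvs_of_cha_of_selmerGroup_ne_bot hGZK hCT hCha 0 0 0 (-578304) (-169277832)
    (integralModelInt_eq_of_map_eq _ (map_mk_int _ _ _ _ _)) 5 11 8 (by decide) (by decide +kernel)
    (by decide) (by decide +kernel) card_c347328cd1_11 (by decide +kernel) hr hK hH hP hnt
    (mod_cast hpD) hpN hI hq hv hSel

/-- **`BSD(E,5)` for `374544bm1`** (`N = 374544 = 2⁴·3⁴·17²`; `5 ∤ N`: GOOD ORDINARY at `5`, `a₅ = 3` — class X9; Cremona model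
`[0, 0, 0, -11271, -461822]`; `ρ̄_{E,5}` irreducible, NOT surjective, of exceptional type `5S4`; analytic rank `0`, `#Ш_an = 25` (`ord₅ = 2`);
c₂ = 1 (I0*), c₃ = 1 (II), c₁₇ = 1 (I0*); bad primes `2` add, `3` add, `17` add; `j = -316368`) — an X9 "SHA row", closed here `μ`-FREE: UPPER half Cha 2005 with the
Heegner-index certificate of the X9 census — index-`ord₅ = 1` rows (two engines, `m_e1 = m_e2`; `HOME/b2b-bsdres-x9/g12/fold/fold_g12.rows.tsv`):
`D = -47`, `m = 10` (engine 1 j070735,j073712, ENGINE 2 agree); `D = -263`, `m = 30` (engine 1 j073712, ENGINE 2 agree); `D = -287`, `m = 20` (engine 1 j073712, ENGINE 2 agree); `D = -359`, `m = 10` (engine 1 j073712, ENGINE 2 agree) — so `ord₅ [E(K) : ℤ y_K] ≤ 1` —, LOWER half the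
descent line: `dim_𝔽₅ Sel^(5)(E/ℚ) = 2` (engine mode `GRH`; `S = [2, 3, 5, 17, 23]`, `Cl(R) = [40, [10, 2, 2]]`, `Cl_S(R) = [1, []]`, `#gens R(S,5) = 32`, `dim K_S(R) = 0`, `5`-saturation `[1, 152, 32]`, all local images complete; independent verifier j107029: VERIFIED) — x11c gen-13 `s4desc` full `5`-descent over `R`, byte copies, this unit's run of record kit j107029; class group of the degree-`24` field `R = ℚ(E[5]∖0)` from `bnfinit` UNDER GRH (Zimmert certificate not attached: this line is GRH-CONDITIONAL); so `Ш(E)[5] ≠ 0`, `25 ∣ #Ш` (Cassels–Tate), `ord₅ #Ш ≤ 2` (Cha): `#Ш(E)[5^∞] = 25`. Kernel-decided: `Δ ≠ 0`, global minimality (Kraus),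
`E[5]` irreducible (`ℓ = 11`, `#Ẽ(𝔽_11) = 6`, `a_11 = 6`, `X² − a_11X + 11` root-free mod `5`), non-CM (`j ∉` the 13 CM values).
Binders: `hGZK`, `hCT`, `hCha` (published); `r_an = 0`, `#Ш_an` (`ord₅ = 2`), the Heegner datum with its index certificate, `hSel` (the descent line).
[cite: Miller2011LMS, Thm. 5.2 and Def. 1.1] [cite: SilvermanAEC2009, Thm. X.4.14] [cite: Cremona2006, Table 1 (Cremona label 374544bm1)] -/
theorem bsdp_c374544bm1 (hGZK : rank_eq_analyticRank_of_analyticRank_le_one)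
    (hCT : exists_casselsTate_pairing (K := ℚ)) (hCha : Cha2005.thm52_padicValNat_shaOrder_le)
    (W : WeierstrassCurve ℚ) (hW : W = ⟨0, 0, 0, -11271, -461822⟩)
    (hr : W.analyticRank = 0)
    {N : ℕ} [NeZero N] {K : Type} [Field K] [NumberField K] (hK : IsImaginaryQuadratic K)
    (hH : SatisfiesHeegnerHypothesis N K) {P : (W.baseChange K).toAffine.Point}
    (hP : IsHeegnerPoint N W K P) (hnt : ¬ IsOfFinAddOrder P)
    (hpD : ¬ (5 : ℤ) ∣ NumberField.discr K) (hpN : ¬ 5 ^ 2 ∣ N)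
    (hI : padicValNat 5 (AddSubgroup.zmultiples P).index ≤ 1)
    {q : ℚ} (hq : shaAn W = (q : ℂ)) (hv : padicValRat 5 q = 2)
    (hSel : W.selmerGroup (5 : ℤ) ≠ ⊥) : BSDp W 5 := by
  subst hW
  haveI := isElliptic_of_discOf_ne_zero 0 0 0 (-11271) (-461822) (by decide +kernel)
  haveI := isGloballyMinimal_of_krausCriterion_bounded₂ 0 0 0 (-11271) (-461822) (by decide +kernel) (by decide +kernel)
    (by decide +kernel)
  haveI : Fact (Nat.Prime 5) := ⟨by norm_num⟩
  haveI : Fact (Nat.Prime 11) := ⟨by norm_num⟩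
  exact bsdp_of_ainvs_of_cha_of_selmerGroup_ne_bot hGZK hCT hCha 0 0 0 (-11271) (-461822)
    (integralModelInt_eq_of_map_eq _ (map_mk_int _ _ _ _ _)) 5 11 6 (by decide) (by decide +kernel)
    (by decide) (by decide +kernel) card_c374544bm1_11 (by decide +kernel) hr hK hH hP hnt
    (mod_cast hpD) hpN hI hq hv hSel

/-- **`BSD(E,5)` for `374544bm2`** (`N = 374544 = 2⁴·3⁴·17²`; `5 ∤ N`: GOOD ORDINARY at `5`, `a₅ = 3` — class X9; Cremona model
`[0, 0, 0, 23409, -2387718]`; `ρ̄_{E,5}` irreducible, NOT surjective, of exceptional type `5S4`; analytic rank `0`, `#Ш_an = 25` (`ord₅ = 2`);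
c₂ = 1 (I0*), c₃ = 1 (II*), c₁₇ = 1 (I0*); bad primes `2` add, `3` add, `17` add; `j = 432`) — an X9 "SHA row", closed here `μ`-FREE: UPPER half Cha 2005 with the
Heegner-index certificate of the X9 census — index-`ord₅ = 1` rows (two engines, `m_e1 = m_e2`; `HOME/b2b-bsdres-x9/g12/fold/fold_g12.rows.tsv`):
`D = -47`, `m = 10` (engine 1 j070736,j073713, ENGINE 2 agree); `D = -263`, `m = 30` (engine 1 j073713, ENGINE 2 agree); `D = -287`, `m = 20` (engine 1 j073713, ENGINE 2 agree) — so `ord₅ [E(K) : ℤ y_K] ≤ 1` —, LOWER half the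
descent line: `dim_𝔽₅ Sel^(5)(E/ℚ) = 2` (engine mode `GRH`; `S = [2, 3, 5, 17, 23]`, `Cl(R) = [40, [10, 2, 2]]`, `Cl_S(R) = [1, []]`, `#gens R(S,5) = 32`, `dim K_S(R) = 0`, `5`-saturation `[1, 170, 32]`, all local images complete; independent verifier j107029: VERIFIED) — x11c gen-13 `s4desc` full `5`-descent over `R`, byte copies, this unit's run of record kit j107029; class group of the degree-`24` field `R = ℚ(E[5]∖0)` from `bnfinit` UNDER GRH (Zimmert certificate not attached: this line is GRH-CONDITIONAL); so `Ш(E)[5] ≠ 0`, `25 ∣ #Ш` (Cassels–Tate), `ord₅ #Ш ≤ 2` (Cha): `#Ш(E)[5^∞] = 25`. Kernel-decided: `Δ ≠ 0`, global minimality (Kraus),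
`E[5]` irreducible (`ℓ = 11`, `#Ẽ(𝔽_11) = 6`, `a_11 = 6`, `X² − a_11X + 11` root-free mod `5`), non-CM (`j ∉` the 13 CM values).
Binders: `hGZK`, `hCT`, `hCha` (published); `r_an = 0`, `#Ш_an` (`ord₅ = 2`), the Heegner datum with its index certificate, `hSel` (the descent line).
[cite: Miller2011LMS, Thm. 5.2 and Def. 1.1] [cite: SilvermanAEC2009, Thm. X.4.14] [cite: Cremona2006, Table 1 (Cremona label 374544bm2)] -/
theorem bsdp_c374544bm2 (hGZK : rank_eq_analyticRank_of_analyticRank_le_one)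
    (hCT : exists_casselsTate_pairing (K := ℚ)) (hCha : Cha2005.thm52_padicValNat_shaOrder_le)
    (W : WeierstrassCurve ℚ) (hW : W = ⟨0, 0, 0, 23409, -2387718⟩)
    (hr : W.analyticRank = 0)
    {N : ℕ} [NeZero N] {K : Type} [Field K] [NumberField K] (hK : IsImaginaryQuadratic K)
    (hH : SatisfiesHeegnerHypothesis N K) {P : (W.baseChange K).toAffine.Point}
    (hP : IsHeegnerPoint N W K P) (hnt : ¬ IsOfFinAddOrder P)
    (hpD : ¬ (5 : ℤ) ∣ NumberField.discr K) (hpN : ¬ 5 ^ 2 ∣ N)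
    (hI : padicValNat 5 (AddSubgroup.zmultiples P).index ≤ 1)
    {q : ℚ} (hq : shaAn W = (q : ℂ)) (hv : padicValRat 5 q = 2)
    (hSel : W.selmerGroup (5 : ℤ) ≠ ⊥) : BSDp W 5 := by
  subst hW
  haveI := isElliptic_of_discOf_ne_zero 0 0 0 23409 (-2387718) (by decide +kernel)
  haveI := isGloballyMinimal_of_krausCriterion_bounded₂ 0 0 0 23409 (-2387718) (by decide +kernel) (by decide +kernel)
    (by decide +kernel)
  haveI : Fact (Nat.Prime 5) := ⟨by norm_num⟩
  haveI : Fact (Nat.Prime 11) := ⟨by norm_num⟩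
  exact bsdp_of_ainvs_of_cha_of_selmerGroup_ne_bot hGZK hCT hCha 0 0 0 23409 (-2387718)
    (integralModelInt_eq_of_map_eq _ (map_mk_int _ _ _ _ _)) 5 11 6 (by decide) (by decide +kernel)
    (by decide) (by decide +kernel) card_c374544bm2_11 (by decide +kernel) hr hK hH hP hnt
    (mod_cast hpD) hpN hI hq hv hSel

/-- **`BSD(E,5)` for `464648c1`** (`N = 464648 = 2³·241²`; `5 ∤ N`: GOOD ORDINARY at `5`, `a₅ = 3` — class X9; Cremona model
`[0, 0, 0, -153972731, -735401758298]`; `ρ̄_{E,5}` irreducible, NOT surjective, of exceptional type `5S4`; analytic rank `0`, `#Ш_an = 100` (`ord₅ = 2`);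
c₂ = 2 (III*), c₂₄₁ = 1 (IV*); bad primes `2` add, `241` add; `j = -34643268`) — an X9 "SHA row", closed here `μ`-FREE: UPPER half Cha 2005 with the
Heegner-index certificate of the X9 census — index-`ord₅ = 1` rows (two engines, `m_e1 = m_e2`; `HOME/b2b-bsdres-x9/g12/fold/fold_g12.rows.tsv`):
`D = -79`, `m = 40` (engine 1 j070732,j073706, ENGINE 2 agree) — so `ord₅ [E(K) : ℤ y_K] ≤ 1` —, LOWER half the
descent line: `dim_𝔽₅ Sel^(5)(E/ℚ) = 2` (engine mode `GRH`; `S = [2, 5, 23, 241]`, `Cl(R) = [60, [60]]`, `Cl_S(R) = [1, []]`, `#gens R(S,5) = 30`, `dim K_S(R) = 0`, `5`-saturation `[1, 264, 30]`, all local images complete; independent verifier j107225: VERIFIED) — x11c gen-13 `s4desc` full `5`-descent over `R`, byte copies, this unit's run of record kit j106443; class group of the degree-`24` field `R = ℚ(E[5]∖0)` from `bnfinit` UNDER GRH (Zimmert certificate not attached: this line is GRH-CONDITIONAL); so `Ш(E)[5] ≠ 0`, `25 ∣ #Ш` (Cassels–Tate), `ord₅ #Ш ≤ 2` (Cha): `#Ш(E)[5^∞]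 = 25`. Kernel-decided: `Δ ≠ 0`, global minimality (Kraus),
`E[5]` irreducible (`ℓ = 3`, `#Ẽ(𝔽_3) = 4`, `a_3 = 0`, `X² − a_3X + 3` root-free mod `5`), non-CM (`j ∉` the 13 CM values).
Binders: `hGZK`, `hCT`, `hCha` (published); `r_an = 0`, `#Ш_an` (`ord₅ = 2`), the Heegner datum with its index certificate, `hSel` (the descent line).
[cite: Miller2011LMS, Thm. 5.2 and Def. 1.1] [cite: SilvermanAEC2009, Thm. X.4.14] [cite: Cremona2006, Table 1 (Cremona label 464648c1)] -/
theorem bsdp_c464648c1 (hGZK : rank_eq_analyticRank_of_analyticRank_le_one)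
    (hCT : exists_casselsTate_pairing (K := ℚ)) (hCha : Cha2005.thm52_padicValNat_shaOrder_le)
    (W : WeierstrassCurve ℚ) (hW : W = ⟨0, 0, 0, -153972731, -735401758298⟩)
    (hr : W.analyticRank = 0)
    {N : ℕ} [NeZero N] {K : Type} [Field K] [NumberField K] (hK : IsImaginaryQuadratic K)
    (hH : SatisfiesHeegnerHypothesis N K) {P : (W.baseChange K).toAffine.Point}
    (hP : IsHeegnerPoint N W K P) (hnt : ¬ IsOfFinAddOrder P)
    (hpD : ¬ (5 : ℤ) ∣ NumberField.discr K) (hpN : ¬ 5 ^ 2 ∣ N)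
    (hI : padicValNat 5 (AddSubgroup.zmultiples P).index ≤ 1)
    {q : ℚ} (hq : shaAn W = (q : ℂ)) (hv : padicValRat 5 q = 2)
    (hSel : W.selmerGroup (5 : ℤ) ≠ ⊥) : BSDp W 5 := by
  subst hW
  haveI := isElliptic_of_discOf_ne_zero 0 0 0 (-153972731) (-735401758298) (by decide +kernel)
  haveI := isGloballyMinimal_of_krausCriterion_bounded₂ 0 0 0 (-153972731) (-735401758298) (by decide +kernel) (by decide +kernel)
    (by decide +kernel)
  haveI : Fact (Nat.Prime 5) := ⟨by norm_num⟩
  haveI : Fact (Nat.Prime 3) := ⟨by norm_num⟩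
  exact bsdp_of_ainvs_of_cha_of_selmerGroup_ne_bot hGZK hCT hCha 0 0 0 (-153972731) (-735401758298)
    (integralModelInt_eq_of_map_eq _ (map_mk_int _ _ _ _ _)) 5 3 4 (by decide) (by decide +kernel)
    (by decide) (by decide +kernel) card_c464648c1_3 (by decide +kernel) hr hK hH hP hnt
    (mod_cast hpD) hpN hI hq hv hSel

end Summit.BirchSwinnertonDyer.Rank1Residual.X9

end
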